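import Literature.MathematicalPhysics.QuantumFieldTheory.Balaban1983to89.B12Form543

/-!
# `Balaban1983to89.B12Ineq544Constant` — [Balaban1987RG1] §5 p. 297, the remainder decay **(5.44)**
# `|Π′_{μν,κλρ}(x − y)| ≦ O(1)E₀ exp(−½δ₁|x − y|)` WITH PRINT'S CONSTANT SHAPE `O(1)·E₀`, the `ℓ¹` norm of `Π′`, and the
# p. 298 arithmetic «all these third order terms in (5.43) are irrelevant»

statement-level skeleton of published theorems with citation tags; proofs where landed; nothing here is a claim
about the Yang–Mills mass gap

CITATION HEADER (lean-in-tree rule).  T. Bałaban, *Renormalization group approach to lattice gauge field theories. I.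
Generation of effective actions in a small field approximation and a coupling constant renormalization in four dimensions*,
Commun. Math. Phys. **109** (1987) 249–301, doi:10.1007/BF01215223 [Balaban1987RG1] (cell paper B12 = «[I]»; held
`paper:balaban1987-cmp109-rg-i-small-field`, journal page = PDF page + 248).  The displays and sentences quoted below were read
first-hand as images on the ×2 renders `b2b-balaban-ref1/pages/1987-cmp109-rg-I-small-field/…-p045-x2.png` (p. 293),
`…-p049-x2.png` (p. 297), `…-p050-x2.png` (p. 298).  Mega-formalization `lit-balaban` (HOME `run/shared/lean/pub/lit-balaban/`),
unit `lit-balaban-r20` gen 43 (B12 fold owner; free-target protocol G.5-34(d), TAKING line HOME/STATUS 2026-08-23T09:44Z).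
SKELETON rows served (cells only): the coarse row `B12.Eq5.42` (§5 (5.10), (5.42)–(5.44); fold owner r20) and the display
owner's rows `B12.Eq5.43-5.44`, `B12.Txt@298` (r09).  ADDITIVE LEAF: imports the pub-balaban b03 lineage's `B12Form543`
(hence `B12Rep537`, `B12Sec2to5`) and restates nothing.

THE PRINT.  p. 293 (5.10): *«|Π_{μν}(x − y)| ≦ O(1)E₀ exp(−δ₁|x − y|), with a positive constant δ₁ determined by δ₀, κ, and
M»*.  p. 297 (5.42): *«β = −(∂²/∂p₁∂p₂ Π₁₂)(0) = −(∂²/∂p_μ∂p_ν Π_{μν})(0) = Σ_x Π_{μν}(x)x_μx_ν for μ ≠ ν. This is the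
fundamental equality defining the β-function.»*; (5.43) the position-space form with the third-order terms
*«Σ [Π′_{μν,κλρ}(x − y) tr(∂_κ∂_λ∂_ρδB_μ)(x)B_ν(y) + Π′_{μν,κ,λρ}(x − y) tr(∂_λ∂_ρδB_μ)(x)(∂_κB_ν)(y) + …]»*; *«The analyticity
properties mentioned after (5.38) imply the corresponding exponential decay properties of the functions in the above formula.
More exactly, we have |Π′_{μν,κλρ}(x − y)| ≦ O(1)E₀ exp(½δ₁|x − y|). (5.44)»* [sic: the minus sign is missing in print; the
decay e^{−½δ₁|x−y|} is meant — HOME/GAPS.md G-B12-07].  p. 298 L1–4: *«In the third order terms in (5.43) we can always shift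
the derivatives onto the other function, so we can write them in the form in which δB is differentiated once, and B twice.
The bound (5.44), and the bounds (4.14), (4.15) for derivatives of δB, B imply that all these third order terms in (5.43) are
irrelevant.»* [sic: (4.17), (4.18) p. 285 are meant — located print slip S-B12-298a: «|(∂_νB_μ)(x)| < α₁(Lʲη)² (4.17)»,
«|(∂_λ∂_νB_μ)(x)| < α₁(Lʲη)^{2+β}, 0 ≦ β ≦ β₀ < 1, (4.18) … The inequalities (4.17), (4.18) hold for the field δB also.»].

WHAT THE TREE HAD.  `B12Rep537.rep538_of_decay510` (b03): from the cell's (5.10) `B12Sec2to5.Decay510 Π C δ₁` and the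
Taylor data (5.36) `TaylorData3 β μ ν Π`, the representation (5.37)/(5.38) with the remainder coefficients
`Π′_{κλρ} = rem538 Π β μ ν (κ,λ,ρ)` bounded by `K(δ₁,d)³·(C + ‖β‖·MQ(δ₁,d))·e^{−δ₁|x|₁}` — the (5.44) decay at the cell's rate
`δ₁` with a constant still carrying the LETTER `‖β‖`; the four closing theorems of `B12Rep538Limit` carry the same letter
(`‖secondMoment‖`).  `B12Sec2to5.secondMoment_abs_le_of_decay510` / `betaPrime510` (b12): `|Σ_xΠ_{μν}(x)x_μx_ν| ≤ β′ :=
C·Σ_x|x|₁²e^{−δ₁|x|₁}`.  `B12Form543.spair` / `spair_eq_sum` (b03): the pairing `Σ_{x,y}R(x − y)f(x)g(y)` of (5.43).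

WHAT THIS FILE PROVES (kernel-checked, 0 sorry, theorems only — no `def`, no new `Prop`, no named fact; axioms standard; the
[folklore] plumbing lemmas are `private`).
* §1 `norm_beta_le_betaPrime`: under (5.10) and the Taylor data, `‖β‖ ≤ β′ = C·Σ_x|x|₁²e^{−δ₁|x|₁}` (by (5.42) `β = Σ_xΠ(x)x_μx_ν`,
  `B12Rep537.beta_eq_542`, and the majorant of b12's `secondMoment_abs_le_of_decay510`).
* §2 **(5.44) WITH PRINT'S CONSTANT SHAPE**: `ineq544_betaPrime` (`|Π′_{κλρ}(x)| ≤ K³(C + β′·MQ)·e^{−δ₁|x|₁}`) and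
  `ineq544_const_mul` (`= [K³(1 + S(δ₁,d)·MQ)]·C·e^{−δ₁|x|₁}`, `S(δ₁,d) = Σ_x|x|₁²e^{−δ₁|x|₁}`): the constant is `O(1)·C` with
  `O(1)` a function of `δ₁` and `d` ONLY — print's «O(1)E₀» for the (5.10) constant `C = O(1)E₀` — at the cell's rate `δ₁`, and
  `ineq544_printed` at print's rate `½δ₁` (weaker); `expBound_rem538` packages it as `ExpBound δ₁ (O(1)·C) Π′`.
* §3 `summable_norm_rem538`, `tsum_norm_rem538_le`: `Π′ ∈ ℓ¹(ℤᵈ)`, `Σ_x|Π′_{κλρ}(x)| ≤ [K³(1 + S·MQ)]·C·Z_d(δ₁)`.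
* §4 the p. 298 arithmetic: `norm_spair_le` — for a kernel `|R(z)| ≤ M e^{−a|z|₁}` and fields `f`, `g` vanishing off finite
  sets with `‖f‖ ≤ F`, `‖g‖ ≤ G`: `|Σ_{x,y}R(x − y)f(x)g(y)| ≤ #supp f · M·Z_d(a) · F·G`; with the (4.17)/(4.18) sizes
  `F = α₁s²` (δB differentiated once), `G = α₁s^{2+β}` (B differentiated twice), `s = Lʲη`: `thirdOrder543_le` —
  `≤ #supp(∂δB) · M·Z_d(a) · α₁²·s^{4+β}`, the (0.29)-type irrelevant law `(Lʲη)^{4+β}`, `4 + β > d = 4`, per unit-lattice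
  site; and `thirdOrder543_rem538_le`, the same with `R = Π′_{κλρ}` and `M = [K³(1 + S·MQ)]·C`.

HONEST SCOPE.  (i) The objects are the b03 lineage's: ONE component kernel `Π : ℤᵈ → ℝ` with the typed (5.10) and the typed
Taylor data (5.36) (the output of the symmetry analysis (5.12)–(5.36), derived elsewhere in the lineage: `B12Transverse536`,
`B12Covariance54`, `B12Rep538Limit`); `μ ≠ ν` as in (5.42).  (ii) §4 is the ARITHMETIC of the p. 298 sentence for ONE
third-order summand of (5.43) with the trace and the finite index sums `Σ_{μνκλρ}` left outside (finite bookkeeping) and the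
sizes of `∂δB`, `∂∂B` entering as the hypotheses `hf`, `hg` in the printed (4.17)/(4.18) shapes — it does not re-derive
(4.17)/(4.18) (rows `B12.Eq4.16-4.18`, files `B12Ineq417*`/`B12Ineq418*`) nor the «shift the derivatives» identity
(`B12Form543.spair_fdelta_left_eq_delta_right`, `form543_remainder_shift`).  (iii) The constant `O(1)` is explicit but not
optimised; print's rate `½δ₁` is weaker than what the Gleason-type representation gives (`δ₁`), as `B12Rep537` already notes.
Failed printed steps: none (HOME/GAPS.md unchanged).  NOT summit progress.

## References
* T. Bałaban, *Renormalization group approach to lattice gauge field theories. I*, Commun. Math. Phys. **109** (1987)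
  249–301, (5.10) p. 293, (5.42)–(5.44) p. 297, p. 298. [Balaban1987RG1]
* K. Gawędzki, A. Kupiainen, *Massless lattice φ⁴₄ theory: rigorous control of a renormalizable asymptotically free model*,
  Commun. Math. Phys. **99** (1985) 197–252, App. 2 (the periodic Gleason device behind `B12Rep537`). [GawedzkiKupiainenMasslessLattice1985]
-/

noncomputable section

namespace Literature.MathematicalPhysics.QuantumFieldTheory.Balaban1983to89.B12Ineq544Constant

open Literature.MathematicalPhysics.QuantumFieldTheory.GawedzkiKupiainen1985.PeriodicGleason
open Literature.MathematicalPhysics.QuantumFieldTheory.Balaban1983to89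
open Literature.MathematicalPhysics.QuantumFieldTheory.Balaban1983to89.B12Rep537
open Literature.MathematicalPhysics.QuantumFieldTheory.Balaban1983to89.B12Form543

variable {d : ℕ}

/-! ## §1 `‖β‖ ≤ β′`: the coefficient of (5.42) is bounded by the (5.10) data alone -/

/-- **(5.42) + (5.10) ⇒ `‖β‖ ≤ β′ = C·Σ_x|x|₁²e^{−δ₁|x|₁}`** (`B12Sec2to5.betaPrime510 d C δ₁`): the coefficient `β` of the
Taylor data (5.36) IS `Σ_xΠ(x)x_μx_ν` for `μ ≠ ν` (`B12Rep537.beta_eq_542`, «the fundamental equality defining the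
β-function»), and each term is dominated by `C|x|₁²e^{−δ₁|x|₁}` under (5.10).
[cite: Balaban1987RG1, (5.42) p.297; (5.10) p.293] -/
theorem norm_beta_le_betaPrime {P : Pt d → ℝ} {C δ₁ : ℝ} {β : ℂ} {μ ν : Fin d} (hδ : 0 < δ₁)
    (h510 : B12Sec2to5.Decay510 P C δ₁) (hT : TaylorData3 β μ ν (ofReal P)) (hμν : μ ≠ ν) :
    ‖β‖ ≤ B12Sec2to5.betaPrime510 d C δ₁ := by
  rw [beta_eq_542 hT hμν, B12Sec2to5.betaPrime510]
  have hS := (B12Sec2to5.majorant_summable hδ d).mul_left C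
  have hpt : ∀ x : Pt d, ‖ofReal P x * ((x μ : ℂ) * (x ν : ℂ))‖ ≤
      C * (B12Sec2to5.l1 x ^ 2 * Real.exp (-δ₁ * B12Sec2to5.l1 x)) := by
    intro x
    have e : ofReal P x * ((x μ : ℂ) * (x ν : ℂ)) = ((P x * (x μ : ℝ) * (x ν : ℝ) : ℝ) : ℂ) := by
      simp only [ofReal]; push_cast; ring
    rw [e, Complex.norm_real, Real.norm_eq_abs]
    exact B12Sec2to5.abs_term_le_of_decay510 h510 μ ν x
  have h := tsum_of_norm_bounded hS.hasSum hpt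
  rwa [tsum_mul_left] at h

/-- The (5.10) constant is non-negative (evaluate at the origin). [cite: Balaban1987RG1, (5.10) p.293] -/
theorem const_nonneg_of_decay510 {P : Pt d → ℝ} {C δ₁ : ℝ} (h510 : B12Sec2to5.Decay510 P C δ₁) : 0 ≤ C :=
  (expBound_of_decay510 h510).nonneg

/-- The majorant sum `S(δ₁,d) = Σ_x|x|₁²e^{−δ₁|x|₁}` is non-negative. [folklore] -/
private theorem majorant_tsum_nonneg (δ₁ : ℝ) (d : ℕ) :
    0 ≤ ∑' x : Pt d, B12Sec2to5.l1 x ^ 2 * Real.exp (-δ₁ * B12Sec2to5.l1 x) :=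
  tsum_nonneg fun _ => mul_nonneg (sq_nonneg _) (Real.exp_pos _).le

/-- `β′ = C · S(δ₁,d)` is non-negative when `C ≥ 0`. [folklore] -/
private theorem betaPrime510_nonneg {C : ℝ} (hC : 0 ≤ C) (δ₁ : ℝ) (d : ℕ) : 0 ≤ B12Sec2to5.betaPrime510 d C δ₁ :=
  mul_nonneg hC (majorant_tsum_nonneg δ₁ d)

/-! ## §2 (5.44) with print's constant shape `O(1)·E₀` -/

/-- **(5.44), constant `K³(C + β′·MQ)`**: for a real kernel with (5.10) `|Π(x)| ≤ Ce^{−δ₁|x|₁}` and Taylor data `β ×`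
those of `Q_{μν}`, `μ ≠ ν`, the remainder coefficients `Π′_{κλρ}` of (5.37)/(5.38) satisfy
`|Π′_{κλρ}(x)| ≤ K(δ₁,d)³·(C + β′·MQ(δ₁,d))·e^{−δ₁|x|₁}` — b03's `rep538_of_decay510` with the letter `‖β‖` replaced by
`β′ = C·Σ|x|₁²e^{−δ₁|x|₁}` (§1). [cite: Balaban1987RG1, (5.44) p.297; (5.10) p.293] -/
theorem ineq544_betaPrime {P : Pt d → ℝ} {C δ₁ : ℝ} {β : ℂ} {μ ν : Fin d} (hδ : 0 < δ₁)
    (h510 : B12Sec2to5.Decay510 P C δ₁) (hT : TaylorData3 β μ ν (ofReal P)) (hμν : μ ≠ ν)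
    (μs : Fin 3 → Fin d) (x : Pt d) :
    ‖rem538 (ofReal P) β μ ν μs x‖ ≤
      K δ₁ d ^ 3 * (C + B12Sec2to5.betaPrime510 d C δ₁ * MQ δ₁ d) * Real.exp (-δ₁ * l1 x) := by
  have h := (rep538_of_decay510 hδ h510 hT).2 μs x
  have hβ := norm_beta_le_betaPrime hδ h510 hT hμν
  have hK : 0 ≤ K δ₁ d ^ 3 := pow_nonneg (K_nonneg hδ d) 3
  have hMQ := MQ_nonneg δ₁ d
  refine h.trans ?_
  apply mul_le_mul_of_nonneg_right _ (Real.exp_pos _).le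
  apply mul_le_mul_of_nonneg_left _ hK
  linarith [mul_le_mul_of_nonneg_right hβ hMQ]

/-- **(5.44) WITH PRINT'S CONSTANT SHAPE `O(1)·E₀`**: `|Π′_{κλρ}(x)| ≤ [K(δ₁,d)³·(1 + S(δ₁,d)·MQ(δ₁,d))]·C·e^{−δ₁|x|₁}`,
`S(δ₁,d) = Σ_x|x|₁²e^{−δ₁|x|₁}` — the bracket depends on `δ₁` and `d` only, `C` is the (5.10) constant (print: `O(1)E₀`,
«with a positive constant δ₁ determined by δ₀, κ, and M»), so this is print's «O(1)E₀» at the (stronger) rate `δ₁`.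
[cite: Balaban1987RG1, (5.44) p.297; (5.10) p.293] -/
theorem ineq544_const_mul {P : Pt d → ℝ} {C δ₁ : ℝ} {β : ℂ} {μ ν : Fin d} (hδ : 0 < δ₁)
    (h510 : B12Sec2to5.Decay510 P C δ₁) (hT : TaylorData3 β μ ν (ofReal P)) (hμν : μ ≠ ν)
    (μs : Fin 3 → Fin d) (x : Pt d) :
    ‖rem538 (ofReal P) β μ ν μs x‖ ≤
      (K δ₁ d ^ 3 * (1 + (∑' y : Pt d, B12Sec2to5.l1 y ^ 2 * Real.exp (-δ₁ * B12Sec2to5.l1 y)) * MQ δ₁ d)) * C *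
        Real.exp (-δ₁ * l1 x) := by
  have h := ineq544_betaPrime hδ h510 hT hμν μs x
  have e : K δ₁ d ^ 3 * (C + B12Sec2to5.betaPrime510 d C δ₁ * MQ δ₁ d) =
      (K δ₁ d ^ 3 * (1 + (∑' y : Pt d, B12Sec2to5.l1 y ^ 2 * Real.exp (-δ₁ * B12Sec2to5.l1 y)) * MQ δ₁ d)) * C := by
    unfold B12Sec2to5.betaPrime510; ring
  rwa [e] at h

/-- The `O(1)` bracket `K³(1 + S·MQ)` is non-negative. [folklore] -/
private theorem bracket544_nonneg {δ₁ : ℝ} (hδ : 0 < δ₁) (d : ℕ) :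
    0 ≤ K δ₁ d ^ 3 * (1 + (∑' y : Pt d, B12Sec2to5.l1 y ^ 2 * Real.exp (-δ₁ * B12Sec2to5.l1 y)) * MQ δ₁ d) :=
  mul_nonneg (pow_nonneg (K_nonneg hδ d) 3)
    (add_nonneg zero_le_one (mul_nonneg (majorant_tsum_nonneg δ₁ d) (MQ_nonneg δ₁ d)))

/-- **(5.44) packaged as an exponential bound** `ExpBound δ₁ ([K³(1 + S·MQ)]·C) Π′_{κλρ}` (the currency of the
Gawędzki–Kupiainen device and of §4 below). [cite: Balaban1987RG1, (5.44) p.297] -/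
theorem expBound_rem538 {P : Pt d → ℝ} {C δ₁ : ℝ} {β : ℂ} {μ ν : Fin d} (hδ : 0 < δ₁)
    (h510 : B12Sec2to5.Decay510 P C δ₁) (hT : TaylorData3 β μ ν (ofReal P)) (hμν : μ ≠ ν)
    (μs : Fin 3 → Fin d) :
    ExpBound δ₁
      ((K δ₁ d ^ 3 * (1 + (∑' y : Pt d, B12Sec2to5.l1 y ^ 2 * Real.exp (-δ₁ * B12Sec2to5.l1 y)) * MQ δ₁ d)) * C)
      (rem538 (ofReal P) β μ ν μs) :=
  fun x => ineq544_const_mul hδ h510 hT hμν μs x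

/-- `e^{−δ₁|x|₁} ≤ e^{−½δ₁|x|₁}` for `δ₁ ≥ 0`: print's rate `½δ₁` is weaker than the cell's `δ₁`. [folklore] -/
private theorem exp_neg_le_exp_neg_half {δ₁ : ℝ} (hδ : 0 ≤ δ₁) (x : Pt d) :
    Real.exp (-δ₁ * l1 x) ≤ Real.exp (-(δ₁ / 2) * l1 x) := by
  apply Real.exp_le_exp.mpr
  have hx : 0 ≤ l1 x := Finset.sum_nonneg fun _ _ => abs_nonneg _
  nlinarith

/-- **(5.44) AS PRINTED** (with the intended minus sign, G-B12-07): `|Π′_{κλρ}(x)| ≦ O(1)·C·exp(−½δ₁|x|₁)`, `O(1) =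
K(δ₁,d)³(1 + S(δ₁,d)·MQ(δ₁,d))`, `C` = the (5.10) constant `O(1)E₀`. [cite: Balaban1987RG1, (5.44) p.297; (5.10) p.293] -/
theorem ineq544_printed {P : Pt d → ℝ} {C δ₁ : ℝ} {β : ℂ} {μ ν : Fin d} (hδ : 0 < δ₁)
    (h510 : B12Sec2to5.Decay510 P C δ₁) (hT : TaylorData3 β μ ν (ofReal P)) (hμν : μ ≠ ν)
    (μs : Fin 3 → Fin d) (x : Pt d) :
    ‖rem538 (ofReal P) β μ ν μs x‖ ≤
      (K δ₁ d ^ 3 * (1 + (∑' y : Pt d, B12Sec2to5.l1 y ^ 2 * Real.exp (-δ₁ * B12Sec2to5.l1 y)) * MQ δ₁ d)) * C *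
        Real.exp (-(δ₁ / 2) * l1 x) := by
  refine (ineq544_const_mul hδ h510 hT hμν μs x).trans ?_
  exact mul_le_mul_of_nonneg_left (exp_neg_le_exp_neg_half hδ.le x)
    (mul_nonneg (bracket544_nonneg hδ d) (const_nonneg_of_decay510 h510))

/-! ## §3 `Π′ ∈ ℓ¹(ℤᵈ)` -/

/-- A kernel with an exponential bound is absolutely summable, `Σ_x|R(x)| ≤ M·Z_d(a)`. [folklore] -/
private theorem tsum_norm_le_of_expBound {a M : ℝ} (ha : 0 < a) {R : Pt d → ℂ} (hR : ExpBound a M R) :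
    Summable (fun x => ‖R x‖) ∧ ∑' x, ‖R x‖ ≤ M * Zd a d := by
  have hS : Summable fun x : Pt d => M * wt a x := (summable_wt ha d).mul_left M
  have hsum : Summable fun x => ‖R x‖ := Summable.of_nonneg_of_le (fun _ => norm_nonneg _) hR hS
  refine ⟨hsum, ?_⟩
  calc ∑' x, ‖R x‖ ≤ ∑' x : Pt d, M * wt a x := Summable.tsum_le_tsum hR hsum hS
    _ = M * Zd a d := by rw [tsum_mul_left, Zd]

/-- **`Π′_{κλρ} ∈ ℓ¹(ℤᵈ)`**: the remainder coefficients of (5.38) are absolutely summable. [cite: Balaban1987RG1, (5.44) p.297] -/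
theorem summable_norm_rem538 {P : Pt d → ℝ} {C δ₁ : ℝ} {β : ℂ} {μ ν : Fin d} (hδ : 0 < δ₁)
    (h510 : B12Sec2to5.Decay510 P C δ₁) (hT : TaylorData3 β μ ν (ofReal P)) (hμν : μ ≠ ν)
    (μs : Fin 3 → Fin d) : Summable fun x => ‖rem538 (ofReal P) β μ ν μs x‖ :=
  (tsum_norm_le_of_expBound hδ (expBound_rem538 hδ h510 hT hμν μs)).1

/-- **`‖Π′_{κλρ}‖_{ℓ¹} ≤ [K³(1 + S·MQ)]·C·Z_d(δ₁)`**, `Z_d(δ₁) = Σ_x e^{−δ₁|x|₁}` — again `O(1)·E₀` with `O(1)` depending on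
`δ₁`, `d` only. [cite: Balaban1987RG1, (5.44) p.297; (5.10) p.293] -/
theorem tsum_norm_rem538_le {P : Pt d → ℝ} {C δ₁ : ℝ} {β : ℂ} {μ ν : Fin d} (hδ : 0 < δ₁)
    (h510 : B12Sec2to5.Decay510 P C δ₁) (hT : TaylorData3 β μ ν (ofReal P)) (hμν : μ ≠ ν)
    (μs : Fin 3 → Fin d) :
    ∑' x, ‖rem538 (ofReal P) β μ ν μs x‖ ≤
      (K δ₁ d ^ 3 * (1 + (∑' y : Pt d, B12Sec2to5.l1 y ^ 2 * Real.exp (-δ₁ * B12Sec2to5.l1 y)) * MQ δ₁ d)) * C *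
        Zd δ₁ d :=
  (tsum_norm_le_of_expBound hδ (expBound_rem538 hδ h510 hT hμν μs)).2

/-! ## §4 p. 298: «all these third order terms in (5.43) are irrelevant» — the arithmetic -/

/-- Translates of the exponential weight over a finite set sum to at most `Z_d(a)`. [folklore] -/
private theorem sum_wt_sub_le_Zd {a : ℝ} (ha : 0 < a) (x : Pt d) (B : Finset (Pt d)) :
    ∑ y ∈ B, wt a (x - y) ≤ Zd a d := by
  have hinj : Set.InjOn (fun y : Pt d => x - y) ↑B := fun y _ y' _ h => sub_right_injective h
  rw [← Finset.sum_image (f := fun z => wt a z) hinj, Zd]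
  exact Summable.sum_le_tsum _ (fun z _ => (wt_pos a z).le) (summable_wt ha d)

/-- **THE PAIRING BOUND behind p. 298 L1–4**: for a translation-invariant kernel with `|R(z)| ≤ Me^{−a|z|₁}` and lattice
functions `f`, `g` vanishing off finite sets with `‖f(x)‖ ≤ F`, `‖g(y)‖ ≤ G`, the (5.43) pairing
`Σ_{x,y}R(x − y)f(x)g(y)` (`B12Form543.spair`) is bounded by `#A · M·Z_d(a) · F·G`, `A ⊇ supp f`.
[cite: Balaban1987RG1, (5.43) p.297, p.298] -/
theorem norm_spair_le {R f g : Pt d → ℂ} {A B : Finset (Pt d)} {a M F G : ℝ} (ha : 0 < a)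
    (hR : ExpBound a M R) (hA : ∀ x, x ∉ A → f x = 0) (hB : ∀ y, y ∉ B → g y = 0)
    (hf : ∀ x, ‖f x‖ ≤ F) (hg : ∀ y, ‖g y‖ ≤ G) :
    ‖spair R f g‖ ≤ A.card * (M * Zd a d * F * G) := by
  have hM : 0 ≤ M := hR.nonneg
  have hF : 0 ≤ F := (norm_nonneg _).trans (hf 0)
  have hG : 0 ≤ G := (norm_nonneg _).trans (hg 0)
  rw [spair_eq_sum hA hB]
  have hpt : ∀ x y : Pt d, ‖R (x - y) * f x * g y‖ ≤ (M * F * G) * wt a (x - y) := by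
    intro x y
    rw [norm_mul, norm_mul]
    have h1 : ‖R (x - y)‖ * ‖f x‖ ≤ M * wt a (x - y) * F :=
      mul_le_mul (hR (x - y)) (hf x) (norm_nonneg _) (mul_nonneg hM (wt_pos a _).le)
    have h2 : ‖R (x - y)‖ * ‖f x‖ * ‖g y‖ ≤ M * wt a (x - y) * F * G :=
      mul_le_mul h1 (hg y) (norm_nonneg _) (mul_nonneg (mul_nonneg hM (wt_pos a _).le) hF)
    calc ‖R (x - y)‖ * ‖f x‖ * ‖g y‖ ≤ M * wt a (x - y) * F * G := h2
      _ = (M * F * G) * wt a (x - y) := by ring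
  have hrow : ∀ x : Pt d, ‖∑ y ∈ B, R (x - y) * f x * g y‖ ≤ M * Zd a d * F * G := by
    intro x
    calc ‖∑ y ∈ B, R (x - y) * f x * g y‖ ≤ ∑ y ∈ B, ‖R (x - y) * f x * g y‖ := norm_sum_le _ _
      _ ≤ ∑ y ∈ B, (M * F * G) * wt a (x - y) := Finset.sum_le_sum fun y _ => hpt x y
      _ = (M * F * G) * ∑ y ∈ B, wt a (x - y) := by rw [Finset.mul_sum]
      _ ≤ (M * F * G) * Zd a d :=
          mul_le_mul_of_nonneg_left (sum_wt_sub_le_Zd ha x B) (mul_nonneg (mul_nonneg hM hF) hG)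
      _ = M * Zd a d * F * G := by ring
  calc ‖∑ x ∈ A, ∑ y ∈ B, R (x - y) * f x * g y‖ ≤ ∑ x ∈ A, ‖∑ y ∈ B, R (x - y) * f x * g y‖ := norm_sum_le _ _
    _ ≤ ∑ x ∈ A, M * Zd a d * F * G := Finset.sum_le_sum fun x _ => hrow x
    _ = A.card * (M * Zd a d * F * G) := by rw [Finset.sum_const, nsmul_eq_mul]

/-- The power-counting identity `α₁s² · α₁s^{2+β} = α₁²·s^{4+β}` (`s = Lʲη > 0`): the (4.17) size of `∂δB` times the
(4.18) size of `∂∂B` is the (0.29)-type irrelevant law, `4 + β > d = 4`. [cite: Balaban1987RG1, (4.17)–(4.18) p.285, (0.29) p.258] -/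
theorem irrelevant_law {α₁ s b : ℝ} (hs : 0 < s) :
    α₁ * s ^ (2 : ℝ) * (α₁ * s ^ (2 + b)) = α₁ ^ 2 * s ^ (4 + b) := by
  have h : s ^ (2 : ℝ) * s ^ (2 + b) = s ^ (4 + b) := by
    rw [← Real.rpow_add hs]; congr 1; ring
  calc α₁ * s ^ (2 : ℝ) * (α₁ * s ^ (2 + b)) = α₁ ^ 2 * (s ^ (2 : ℝ) * s ^ (2 + b)) := by ring
    _ = α₁ ^ 2 * s ^ (4 + b) := by rw [h]

/-- **p. 298 L1–4, QUANTIFIED**: «we can write them in the form in which δB is differentiated once, and B twice. The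
bound (5.44), and the bounds (4.17), (4.18) [print: (4.14), (4.15) — S-B12-298a] for derivatives of δB, B imply that all
these third order terms in (5.43) are irrelevant»: a third-order pairing `Σ_{x,y}R(x − y)f(x)g(y)` with `|R(z)| ≤ Me^{−a|z|₁}`
((5.44)), `‖f‖ ≤ α₁s²` (a first derivative of `δB`, (4.17) «for the field δB also») and `‖g‖ ≤ α₁s^{2+β}` (a second
derivative of `B`, (4.18)), `s = Lʲη`, is at most `#supp f · M·Z_d(a) · α₁²·s^{4+β}` — a positive power `4 + β > 4 = d` of
`Lʲη` per unit-lattice site, i.e. an irrelevant term in the sense of (0.29). [cite: Balaban1987RG1, p.298; (5.43)–(5.44) p.297; (4.17)–(4.18) p.285] -/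
theorem thirdOrder543_le {R f g : Pt d → ℂ} {A B : Finset (Pt d)} {a M α₁ s b : ℝ} (ha : 0 < a)
    (hR : ExpBound a M R) (hA : ∀ x, x ∉ A → f x = 0) (hB : ∀ y, y ∉ B → g y = 0) (hs : 0 < s)
    (hf : ∀ x, ‖f x‖ ≤ α₁ * s ^ (2 : ℝ)) (hg : ∀ y, ‖g y‖ ≤ α₁ * s ^ (2 + b)) :
    ‖spair R f g‖ ≤ A.card * (M * Zd a d * (α₁ ^ 2 * s ^ (4 + b))) := by
  have h := norm_spair_le ha hR hA hB hf hg
  rwa [mul_assoc (M * Zd a d), irrelevant_law hs] at h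

/-- **The same for the actual remainder kernel `R = Π′_{κλρ}` of (5.38)** with its §2 constant `[K³(1 + S·MQ)]·C`:
`|Σ_{x,y}Π′_{κλρ}(x − y)f(x)g(y)| ≤ #supp f · [K³(1 + S·MQ)]·C·Z_d(δ₁) · α₁²·(Lʲη)^{4+β}`.
[cite: Balaban1987RG1, p.298; (5.44) p.297; (5.10) p.293] -/
theorem thirdOrder543_rem538_le {P : Pt d → ℝ} {C δ₁ : ℝ} {β : ℂ} {μ ν : Fin d} (hδ : 0 < δ₁)
    (h510 : B12Sec2to5.Decay510 P C δ₁) (hT : TaylorData3 β μ ν (ofReal P)) (hμν : μ ≠ ν)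
    (μs : Fin 3 → Fin d) {f g : Pt d → ℂ} {A B : Finset (Pt d)} {α₁ s b : ℝ}
    (hA : ∀ x, x ∉ A → f x = 0) (hB : ∀ y, y ∉ B → g y = 0) (hs : 0 < s)
    (hf : ∀ x, ‖f x‖ ≤ α₁ * s ^ (2 : ℝ)) (hg : ∀ y, ‖g y‖ ≤ α₁ * s ^ (2 + b)) :
    ‖spair (rem538 (ofReal P) β μ ν μs) f g‖ ≤
      A.card * ((K δ₁ d ^ 3 * (1 + (∑' y : Pt d, B12Sec2to5.l1 y ^ 2 * Real.exp (-δ₁ * B12Sec2to5.l1 y)) * MQ δ₁ d)) *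
        C * Zd δ₁ d * (α₁ ^ 2 * s ^ (4 + b))) :=
  thirdOrder543_le hδ (expBound_rem538 hδ h510 hT hμν μs) hA hB hs hf hg

end Literature.MathematicalPhysics.QuantumFieldTheory.Balaban1983to89.B12Ineq544Constant

end
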